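import Summits.CriticalPhenomena.SAWScalingLimit.Theorems.CriticalBubbleBound.Negative.CriticalBubbleBoundRandomWalkFalse

/-!
# Negative-side results for the crux `SAWTotalPositivity.CriticalBubbleBound` (stmt-CriticalPhenomena-7117):
word combinatorics for the memoryless comparison model (work-file §17, part 1 of 2)

* the diagonal-coordinates BIJECTION between nearest-neighbour words of `ℤ²` and pairs of subsets
  (`exists_pairWord_eq`, `wEnd_pairWord_eq`): exact endpoint bookkeeping, whence the exact Pólya
  count `w_{2m+1}(e₀) = C(2m+1,m+1)²` (upper half `rwCountAt_e₀_le_choose_sq`; the lower half is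
  `choose_sq_le_rwCountAt` of `CriticalBubbleBoundRandomWalkFalse`), parity, and
  `w_{2m+1}((1,-2)) ≥ C(2m+1,m) C(2m+1,m+2)`;
* the REFLECTION PRINCIPLE at level `-1` (`reflectTail`, an involution on dipping words exchanging
  the endpoints `(x, y) ↔ (x, -2-y)`), used in part 2
  (`CriticalBubbleBoundBoundaryBulkMemoryless`) to show that the memoryless half-plane kernel is
  finite at criticality while the bulk kernel is infinite.

Refuter `cdisprove` (standing adversary, gen 4); the full indexed work file is
`Summits/CriticalPhenomena/SAWScalingLimit/Cruxes/CriticalBubbleBound/Disproof.lean` (§17).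
-/

noncomputable section

open MeasureTheory Filter Topology Set Function
open Literature.Probability.LatticeModels
open Literature.Probability.RandomPlanarGeometry Literature.Probability.RandomPlanarGeometry.SAW
open scoped ENNReal NNReal BigOperators

namespace Summit.CriticalPhenomena.SAWScalingLimit.Theorems.CriticalBubbleBound.Negative

/-! ## §17 Boundary versus bulk in the memoryless model

### The diagonal-coordinates bijection: exact endpoint bookkeeping for ALL words -/

/-- The first bit of a letter: `[dx + dy = 1]`. [folklore] -/
def abit (d : Step) : Bool := decide (Step.dx d + Step.dy d = 1)

/-- The second bit of a letter: `[dx - dy = 1]`. [folklore] -/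
def bbit (d : Step) : Bool := decide (Step.dx d - Step.dy d = 1)

/-- `letter` inverts the two bits. [folklore] -/
theorem letter_abit_bbit (d : Step) : letter (abit d) (bbit d) = d := by
  revert d; decide

/-- Endpoint of `pairWord A B` in general: `(#A + #B - m, #A - #B)`. [folklore] -/
theorem wEnd_pairWord_eq {m : ℕ} (A B : Finset (Fin m)) :
    wEnd (pairWord A B) = ![(A.card : ℤ) + B.card - m, (A.card : ℤ) - B.card] := by
  have hsum : wEnd (pairWord A B) =
      ∑ i : Fin m, Step.vec (letter (decide (i ∈ A)) (decide (i ∈ B))) := wEnd_ofFn _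
  have hx : 2 * wEnd (pairWord A B) 0 = (2 * (A.card : ℤ) - m) + (2 * (B.card : ℤ) - m) := by
    rw [hsum, Finset.sum_apply, Finset.mul_sum]
    simp only [Step.vec_apply_zero, two_mul_dx_letter]
    rw [Finset.sum_add_distrib, sum_sign, sum_sign]
  have hy : 2 * wEnd (pairWord A B) 1 = (2 * (A.card : ℤ) - m) - (2 * (B.card : ℤ) - m) := by
    rw [hsum, Finset.sum_apply, Finset.mul_sum]
    simp only [Step.vec_apply_one, two_mul_dy_letter]
    rw [Finset.sum_sub_distrib, sum_sign, sum_sign]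
  funext j
  fin_cases j
  · simp only [Fin.zero_eta, Fin.isValue, Matrix.cons_val_zero]
    omega
  · simp only [Fin.mk_one, Fin.isValue, Matrix.cons_val_one, Matrix.cons_val_fin_one]
    omega

/-- Every word is a `pairWord` (the diagonal coordinates are a bijection). [folklore] -/
theorem exists_pairWord_eq {m : ℕ} {w : List Step} (hw : w.length = m) :
    ∃ A B : Finset (Fin m), pairWord A B = w := by
  subst hw
  refine ⟨Finset.univ.filter (fun i => abit (w.get i) = true),
    Finset.univ.filter (fun i => bbit (w.get i) = true), ?_⟩
  apply List.ext_getElem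
  · simp
  · intro i h1 h2
    simp only [pairWord, List.getElem_ofFn]
    have key := letter_abit_bbit w[i]
    convert key using 2 <;> simp

/-- Exact endpoint bookkeeping: a word of length `m` ending at `v` comes from a pair `(A, B)`
with `2#A = m + v₀ + v₁` and `2#B = m + v₀ - v₁`. [folklore] -/
theorem exists_pairWord_eq_of_wEnd {m : ℕ} {w : List Step} (hw : w.length = m) {v : Site 2}
    (hv : wEnd w = v) :
    ∃ A B : Finset (Fin m), pairWord A B = w ∧ 2 * (A.card : ℤ) = m + v 0 + v 1 ∧
      2 * (B.card : ℤ) = m + v 0 - v 1 := by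
  obtain ⟨A, B, hAB⟩ := exists_pairWord_eq hw
  refine ⟨A, B, hAB, ?_, ?_⟩
  · have h0 := congrFun (wEnd_pairWord_eq A B) 0
    have h1 := congrFun (wEnd_pairWord_eq A B) 1
    rw [hAB, hv] at h0 h1
    simp only [Matrix.cons_val_zero, Matrix.cons_val_one, Matrix.cons_val_fin_one] at h0 h1
    omega
  · have h0 := congrFun (wEnd_pairWord_eq A B) 0
    have h1 := congrFun (wEnd_pairWord_eq A B) 1
    rw [hAB, hv] at h0 h1
    simp only [Matrix.cons_val_zero, Matrix.cons_val_one, Matrix.cons_val_fin_one] at h0 h1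
    omega

/-- UPPER bound by subset pairs: if every pair `(A, B)` whose word ends at `v` has
`#A = a`, `#B = b`, then `w_n(v) ≤ C(n,a) C(n,b)`. [folklore] -/
theorem rwCountAt_le_choose_mul_choose (n : ℕ) (v : Site 2) (a b : ℕ)
    (hab : ∀ A B : Finset (Fin n), wEnd (pairWord A B) = v → A.card = a ∧ B.card = b) :
    rwCountAt n v ≤ n.choose a * n.choose b := by
  classical
  rw [rwCountAt]
  set T : Finset (Finset (Fin n) × Finset (Fin n)) :=
    (Finset.univ.powersetCard a) ×ˢ (Finset.univ.powersetCard b) with hTdef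
  have hT : T.card = n.choose a * n.choose b := by
    rw [hTdef, Finset.card_product, Finset.card_powersetCard, Finset.card_powersetCard,
      Finset.card_univ, Fintype.card_fin]
  rw [← hT]
  refine le_trans (Finset.card_le_card
    (t := T.image fun p : Finset (Fin n) × Finset (Fin n) => pairWord p.1 p.2) ?_)
    Finset.card_image_le
  intro w hw
  rw [Finset.mem_filter, mem_words] at hw
  obtain ⟨A, B, hAB⟩ := exists_pairWord_eq hw.1
  rw [Finset.mem_image]
  refine ⟨(A, B), ?_, hAB⟩
  have h := hab A B (by rw [hAB]; exact hw.2)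
  rw [hTdef, Finset.mem_product, Finset.mem_powersetCard, Finset.mem_powersetCard]
  exact ⟨⟨Finset.subset_univ _, h.1⟩, ⟨Finset.subset_univ _, h.2⟩⟩

/-- LOWER bound by subset pairs: if every pair with `#A = a`, `#B = b` gives a word ending at
`v`, then `C(n,a) C(n,b) ≤ w_n(v)`. [folklore] -/
theorem choose_mul_choose_le_rwCountAt (n : ℕ) (v : Site 2) (a b : ℕ)
    (hab : ∀ A B : Finset (Fin n), A.card = a → B.card = b → wEnd (pairWord A B) = v) :
    n.choose a * n.choose b ≤ rwCountAt n v := by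
  classical
  set S : Finset (Finset (Fin n) × Finset (Fin n)) :=
    (Finset.univ.powersetCard a) ×ˢ (Finset.univ.powersetCard b) with hSdef
  have hS : S.card = n.choose a * n.choose b := by
    rw [hSdef, Finset.card_product, Finset.card_powersetCard, Finset.card_powersetCard,
      Finset.card_univ, Fintype.card_fin]
  rw [← hS, rwCountAt]
  have hinj : Set.InjOn
      (fun p : Finset (Fin n) × Finset (Fin n) => pairWord p.1 p.2) S := by
    intro p _ q _ h
    obtain ⟨h1, h2⟩ := pairWord_inj h
    exact Prod.ext h1 h2
  rw [← Finset.card_image_of_injOn hinj]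
  refine Finset.card_le_card ?_
  intro w hw
  rw [Finset.mem_image] at hw
  obtain ⟨p, hp, rfl⟩ := hw
  rw [hSdef, Finset.mem_product, Finset.mem_powersetCard, Finset.mem_powersetCard] at hp
  rw [Finset.mem_filter, mem_words, length_pairWord]
  exact ⟨rfl, hab _ _ hp.1.2 hp.2.2⟩

/-- **EXACT PÓLYA COUNT, upper half**: `w_{2m+1}(e₀) ≤ C(2m+1, m+1)²` (with §14's lower bound:
equality). [folklore] -/
theorem rwCountAt_e₀_le_choose_sq (m : ℕ) :
    rwCountAt (2 * m + 1) e₀ ≤ ((2 * m + 1).choose (m + 1)) ^ 2 := by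
  rw [sq]
  refine rwCountAt_le_choose_mul_choose _ _ _ _ fun A B h => ?_
  have h0 := congrFun (wEnd_pairWord_eq A B) 0
  have h1 := congrFun (wEnd_pairWord_eq A B) 1
  rw [h] at h0 h1
  simp only [e₀, Matrix.cons_val_zero, Matrix.cons_val_one, Matrix.cons_val_fin_one] at h0 h1
  constructor <;> omega

/-- The reflected target `v₂ = (1, -2)` (image of `e₀` under `y ↦ -2 - y`). [folklore] -/
def v₂ : Site 2 := ![1, -2]

/-- `w_{2m+1}((1,-2)) ≥ C(2m+1, m) · C(2m+1, m+2)`. [folklore] -/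
theorem choose_mul_choose_le_rwCountAt_v₂ (m : ℕ) :
    (2 * m + 1).choose m * (2 * m + 1).choose (m + 2) ≤ rwCountAt (2 * m + 1) v₂ := by
  refine choose_mul_choose_le_rwCountAt _ _ _ _ fun A B hA hB => ?_
  rw [wEnd_pairWord_eq, hA, hB]
  unfold v₂
  funext j
  fin_cases j
  · simp only [Fin.zero_eta, Fin.isValue, Matrix.cons_val_zero]
    push_cast
    ring
  · simp only [Fin.mk_one, Fin.isValue, Matrix.cons_val_one, Matrix.cons_val_fin_one]
    push_cast
    ring

/-- PARITY for words: `w_n(e₀) = 0` for even `n` (`ℤ²` is bipartite). [folklore] -/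
theorem rwCountAt_e₀_eq_zero_of_even {n : ℕ} (hn : Even n) : rwCountAt n e₀ = 0 := by
  rw [rwCountAt, Finset.card_eq_zero, Finset.filter_eq_empty_iff]
  intro w hw hv
  rw [mem_words] at hw
  obtain ⟨A, B, -, hA, -⟩ := exists_pairWord_eq_of_wEnd hw hv
  simp only [e₀, Matrix.cons_val_zero, Matrix.cons_val_one, Matrix.cons_val_fin_one] at hA
  obtain ⟨k, rfl⟩ := hn
  omega


/-! ### The reflection principle at level `-1` (words that dip below the axis) -/

/-- Vertical flip of a letter: up `↔` down, horizontal letters fixed. [folklore] -/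
def flipUD (d : Step) : Step := if d = 1 then 3 else if d = 3 then 1 else d

/-- The flip keeps `dx`. [folklore] -/
@[simp] theorem dx_flipUD (d : Step) : Step.dx (flipUD d) = Step.dx d := by revert d; decide

/-- The flip negates `dy`. [folklore] -/
@[simp] theorem dy_flipUD (d : Step) : Step.dy (flipUD d) = -Step.dy d := by revert d; decide

/-- The flip is an involution. [folklore] -/
@[simp] theorem flipUD_flipUD (d : Step) : flipUD (flipUD d) = d := by revert d; decide

/-- Abscissa of a flipped word: unchanged. [folklore] -/
theorem wEnd_map_flipUD_zero (w : List Step) : wEnd (w.map flipUD) 0 = wEnd w 0 := by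
  induction w with
  | nil => simp
  | cons d w ih =>
    rw [List.map_cons, wEnd_cons, wEnd_cons, Pi.add_apply, Pi.add_apply, ih]
    simp [Step.vec]

/-- Ordinate of a flipped word: negated. [folklore] -/
theorem wEnd_map_flipUD_one (w : List Step) : wEnd (w.map flipUD) 1 = -wEnd w 1 := by
  induction w with
  | nil => simp
  | cons d w ih =>
    rw [List.map_cons, wEnd_cons, wEnd_cons, Pi.add_apply, Pi.add_apply, ih]
    simp [Step.vec]
    ring

/-- `map flipUD` is an involution on words. [folklore] -/
@[simp] theorem map_flipUD_map_flipUD (w : List Step) : (w.map flipUD).map flipUD = w := by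
  rw [List.map_map]
  convert List.map_id w
  funext d
  simp

/-- One step changes the ordinate by at least `-1`. [folklore] -/
theorem traj_succ_one_ge (w : List Step) {i : ℕ} (hi : i < w.length) :
    traj w i 1 - 1 ≤ traj w (i + 1) 1 := by
  rw [traj_succ w hi, Pi.add_apply, Step.vec_apply_one]
  have : -1 ≤ Step.dy w[i] := by
    generalize w[i] = d
    revert d; decide
  linarith

/-- The word's ordinate reaches level `-1` or lower at some time `≤ |w|`. [folklore] -/
def Dips (w : List Step) : Prop := ∃ i, i ≤ w.length ∧ traj w i 1 ≤ -1

open Classical in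
/-- The first time the ordinate is `≤ -1` (junk `0` for words that do not dip). [folklore] -/
def dipTime (w : List Step) : ℕ := if h : Dips w then Nat.find h else 0

/-- The dip time of a dipping word is a time `≤ |w|` with ordinate `≤ -1`. [folklore] -/
theorem dipTime_spec {w : List Step} (h : Dips w) :
    dipTime w ≤ w.length ∧ traj w (dipTime w) 1 ≤ -1 := by
  classical
  rw [dipTime, dif_pos h]
  exact Nat.find_spec h

/-- The dip time never exceeds the length. [folklore] -/
theorem dipTime_le_length (w : List Step) : dipTime w ≤ w.length := by
  classical
  by_cases h : Dips w
  · exact (dipTime_spec h).1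
  · rw [dipTime, dif_neg h]; exact Nat.zero_le _

/-- Before the dip time the ordinate is `≥ 0`. [folklore] -/
theorem traj_nonneg_of_lt_dipTime {w : List Step} (h : Dips w) {i : ℕ} (hi : i < dipTime w) :
    0 ≤ traj w i 1 := by
  classical
  rw [dipTime, dif_pos h] at hi
  have hmin := Nat.find_min h hi
  have hil : i ≤ w.length := hi.le.trans (Nat.find_spec h).1
  push Not at hmin
  have := hmin hil
  omega

/-- The dip time is positive (the walk starts at ordinate `0`). [folklore] -/
theorem dipTime_pos {w : List Step} (h : Dips w) : 0 < dipTime w := by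
  rcases Nat.eq_zero_or_pos (dipTime w) with h0 | h0
  · have := (dipTime_spec h).2
    rw [h0, traj_zero] at this
    simp at this
  · exact h0

/-- At the dip time the ordinate is EXACTLY `-1` (discrete intermediate values). [folklore] -/
theorem traj_dipTime_eq {w : List Step} (h : Dips w) : traj w (dipTime w) 1 = -1 := by
  obtain ⟨hle, hτ⟩ := dipTime_spec h
  have hpos := dipTime_pos h
  obtain ⟨k, hk⟩ : ∃ k, dipTime w = k + 1 := ⟨dipTime w - 1, by omega⟩
  have hk' : k < w.length := by omega
  have h1 := traj_succ_one_ge w hk'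
  have h2 := traj_nonneg_of_lt_dipTime h (i := k) (by omega)
  rw [← hk] at h1
  omega

/-- REFLECTION OF THE TAIL: keep the word up to its dip time, flip every later letter. [folklore] -/
def reflectTail (w : List Step) : List Step :=
  w.take (dipTime w) ++ (w.drop (dipTime w)).map flipUD

/-- Reflection keeps the length. [folklore] -/
@[simp] theorem length_reflectTail (w : List Step) : (reflectTail w).length = w.length := by
  have := dipTime_le_length w
  simp [reflectTail, List.length_take, List.length_drop, min_eq_left this]
  omega

/-- The kept prefix has length the dip time. [folklore] -/
theorem length_take_dipTime (w : List Step) : (w.take (dipTime w)).length = dipTime w := by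
  rw [List.length_take, min_eq_left (dipTime_le_length w)]

/-- Up to the dip time the reflected word runs with the original. [folklore] -/
theorem traj_reflectTail_of_le (w : List Step) {i : ℕ} (hi : i ≤ dipTime w) :
    traj (reflectTail w) i = traj w i := by
  rw [reflectTail, traj_append_left _ _ (by rw [length_take_dipTime]; exact hi), traj_take _ hi]

/-- Splitting a trajectory at time `t`. [folklore] -/
theorem traj_add_eq (w : List Step) {t : ℕ} (ht : t ≤ w.length) (k : ℕ) :
    traj w (t + k) = traj w t + wEnd ((w.drop t).take k) := by
  have h := traj_append_right (w.take t) (w.drop t) k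
  rw [List.take_append_drop, List.length_take, min_eq_left ht] at h
  rw [h]
  rfl

/-- After the dip time: same abscissa, ordinate reflected in the level of the dip. [folklore] -/
theorem traj_reflectTail_add (w : List Step) (k : ℕ) :
    traj (reflectTail w) (dipTime w + k) 0 = traj w (dipTime w + k) 0 ∧
      traj (reflectTail w) (dipTime w + k) 1 = 2 * traj w (dipTime w) 1 - traj w (dipTime w + k) 1 := by
  have hsplit := traj_add_eq w (dipTime_le_length w) k
  have hrefl : traj (reflectTail w) (dipTime w + k) =
      traj w (dipTime w) + wEnd ((((w.drop (dipTime w))).take k).map flipUD) := by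
    have h := traj_append_right (w.take (dipTime w)) ((w.drop (dipTime w)).map flipUD) k
    rw [length_take_dipTime] at h
    rw [reflectTail, h, traj, List.map_take]
    rfl
  rw [hrefl, hsplit, Pi.add_apply, Pi.add_apply, Pi.add_apply, Pi.add_apply,
    wEnd_map_flipUD_zero, wEnd_map_flipUD_one]
  exact ⟨rfl, by ring⟩

/-- The reflected word dips at the same time. [folklore] -/
theorem dipTime_reflectTail {w : List Step} (h : Dips w) :
    Dips (reflectTail w) ∧ dipTime (reflectTail w) = dipTime w := by
  classical
  have hτ := dipTime_spec h
  have hD : Dips (reflectTail w) := ⟨dipTime w, by rw [length_reflectTail]; exact hτ.1, by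
    rw [traj_reflectTail_of_le w le_rfl]; exact hτ.2⟩
  refine ⟨hD, ?_⟩
  rw [dipTime, dif_pos hD, Nat.find_eq_iff]
  refine ⟨⟨by rw [length_reflectTail]; exact hτ.1, by rw [traj_reflectTail_of_le w le_rfl]; exact hτ.2⟩,
    fun n hn => ?_⟩
  rw [traj_reflectTail_of_le w hn.le]
  have := traj_nonneg_of_lt_dipTime h hn
  omega

/-- Reflecting twice restores a dipping word. [folklore] -/
theorem reflectTail_reflectTail {w : List Step} (h : Dips w) : reflectTail (reflectTail w) = w := by
  have hτ := (dipTime_reflectTail h).2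
  conv_lhs => rw [reflectTail, hτ]
  rw [reflectTail, List.take_left' (length_take_dipTime w), List.drop_left' (length_take_dipTime w),
    map_flipUD_map_flipUD, List.take_append_drop]

/-- Endpoint of the reflection of a dipping word: `(x, y) ↦ (x, -2 - y)`. [folklore] -/
theorem wEnd_reflectTail {w : List Step} (h : Dips w) :
    wEnd (reflectTail w) 0 = wEnd w 0 ∧ wEnd (reflectTail w) 1 = -2 - wEnd w 1 := by
  obtain ⟨k, hk⟩ : ∃ k, w.length = dipTime w + k := ⟨w.length - dipTime w, by
    have := dipTime_le_length w; omega⟩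
  have h1 := traj_reflectTail_add w k
  rw [← hk, traj_length, ← length_reflectTail w, traj_length, traj_dipTime_eq h] at h1
  refine ⟨h1.1, ?_⟩
  rw [h1.2]
  ring

end Summit.CriticalPhenomena.SAWScalingLimit.Theorems.CriticalBubbleBound.Negative
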